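import Literature.Barriers.SmoothPoincare4.ExoticContractibleClaimGeneratorsProofs
import Literature.Topology.FourManifolds.CobordismProductRegion
import Literature.Topology.FourManifolds.SolidTorusShellTwist
import HarnessLib

/-!
# The Claim of Akbulut–Ruberman's Theorem A: the generators extend over the cobordism

Fourth-level sibling proof file of `Literature/Barriers/SmoothPoincare4/ExoticContractible.lean`
(barrier `ContractibleBarrierFour`), for the fact seat of (C)
`akbulutRuberman2016_symmetryKillingCobordism` (`ExoticContractibleTheoremAProofs.lean`), whose
conjunct (ii) is the extension property `FarEndDiffeosExtend X` of the Claim in the proof of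
Thm. A of S. Akbulut, D. Ruberman, *Absolutely exotic compact 4-manifolds*, Comment. Math.
Helv. 91 (2016), §3. The sibling `ExoticContractibleClaimGeneratorsProofs.lean` reduced
`FarEndDiffeosExtend X` to a generating set of `Diff(N)` each of whose members extends over `X`
ON THE NOSE with near end isotopic to `id_M`; this file proves that **the printed generators do
so extend**, i.e. formalizes the second half of the printed proof of the Claim:

> "It follows trivially that the isotopy classes of diffeomorphisms of `𝕋 × [0, 1]` that
> preserve the components, relative to the boundary is a sum of copies of `ℤ ⊕ ℤ`, with
> generators as described [the Dehn twists `(z, w, t) ↦ (e^{2πiat} z, e^{2πibt} w, t)`]. Any such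
> generator extends in a natural way over `S¹ × D²`. It is easy to see that the extension, as a
> diffeomorphism of `S¹ × D²`, is isotopic to the identity, via an isotopy that is the identity
> on the boundary. [formulas `F`, `F_s`]"

In the tree's language (all proved, in the two imported topic files written for this seat):
over a toral shell `U` around a component `Lᵢ` of the link, the cobordism
`X = M × I - (L × D² × I) ∪ ∐ᵢ (S³ × I - Cᵢ × D²)` of Lemma 2.3 is a product — a
`Cobordism.ProductRegion` (`CobordismProductRegion.lean`) whose base `U ⊆ M` is the shell of a
solid-torus chart `ψ : M ⊇ ν(Lᵢ) ⇀ 𝕊 1 × ℝ²` of `M` and whose top `top(U) ⊆ N` is the collar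
`Tᵢ × [0, 1]` of the JSJ torus; the generator is the shell twist `shellTwist a b`
(`SolidTorusShellTwist.lean`) read in `N` through `top ∘ ψ⁻¹`, its "natural" extension over `X`
is the shell twist at every level of the product region (`ProductRegion.exists_extension`), whose
near end is the shell twist `k` of the solid torus `ν(Lᵢ) ⊆ M`, isotopic to `id_M` by the
printed isotopy `F_s` (`isIsotopic_refl_of_shellTwist`).

* `exists_extension_shellTwist` — for a product region `R` of `X` and a solid-torus chart `ψ` of
  `M` whose closed shell `ψ⁻¹(𝕊 1 × {1 ≤ ‖w‖ ≤ 2})` lies in the base of `R`: the shell twist `g`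
  of `N` (the transport of the shell twist `k` of `M` along `R`) extends over `X` on the nose,
  `G ∘ inr = inr ∘ g`, `G ∘ inl = inl ∘ k`, and `k` is isotopic to `id_M` — the clause `hS` of
  `farEndDiffeosExtend_of_generators_closure` for `s = g`;
* `farEndDiffeosExtend_of_shellTwists_generate` — hence **if `Diff(N)` is generated up to
  isotopy by such shell twists along product regions of `X`, then `FarEndDiffeosExtend X`**.

What this leaves of conjunct (ii) of (C) is exactly the three-dimensional first half of the
Claim — that for the `N` of Lemma 2.3 (with `L`, `J = 11n42` as in Cor. 2.5, Prop. 2.6) the Dehn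
twists along the tori `Tᵢ × [0, 1]` generate `π₀ Diff(N) ≅ ⊕ⁿ (ℤ ⊕ ℤ)` (JSJ decomposition,
trivial symmetry groups of the hyperbolic pieces, Waldhausen) — together with the product
regions of the constructed `X` over the shells; neither has vocabulary in the tree yet.
Everything here is proved; no named facts are introduced.

## References

* S. Akbulut, D. Ruberman, *Absolutely exotic compact 4-manifolds*, Comment. Math. Helv. 91
  (2016), 1–19, §3, proof of Thm. A, Claim and its proof. [AkbulutRuberman2016]
* M. W. Hirsch, *Differential Topology*, GTM 33 (1976), Ch. 8 §1. [HirschDT1976]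
-/

noncomputable section

open scoped Manifold ContDiff
open Function Set Metric
open Literature.Topology.FourManifolds

namespace Literature.Barriers.SmoothPoincare4

universe u

variable {M N : Type u} [TopologicalSpace M] [ChartedSpace (EuclideanSpace ℝ (Fin 3)) M]
  [TopologicalSpace N] [ChartedSpace (EuclideanSpace ℝ (Fin 3)) N]

/-- Off the closed shell `1 ≤ ‖w‖ ≤ 2` the shell twist is the identity. [folklore] -/
theorem shellTwist_apply_of_not_mem_shell (a b : ℤ)
    {p : (Metric.sphere (0 : EuclideanSpace ℝ (Fin 2)) 1) × EuclideanSpace ℝ (Fin 2)}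
    (hp : p ∉ (univ : Set (Metric.sphere (0 : EuclideanSpace ℝ (Fin 2)) 1)) ×ˢ
      (closedBall (0 : EuclideanSpace ℝ (Fin 2)) 2 ∩ (ball (0 : EuclideanSpace ℝ (Fin 2)) 1)ᶜ)) :
    shellTwist a b p = p := by
  by_cases h2 : ‖p.2‖ ≤ 2
  · have h1 : ‖p.2‖ < 1 := by
      by_contra h1
      exact hp ⟨mem_univ _, mem_closedBall_zero_iff.2 h2, fun h => h1 (mem_ball_zero_iff.1 h)⟩
    exact shellTwist_apply_of_norm_le_one a b h1.le
  · exact shellTwist_apply_of_two_le_norm a b (not_le.1 h2).le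

/-- **The generators of the Claim extend over the cobordism, isotopically to the identity on the
near end** (Akbulut–Ruberman 2016, §3, proof of the Claim: "Any such generator extends in a
natural way over `S¹ × D²` … isotopic to the identity, via an isotopy that is the identity on the
boundary"). Let `X` be a cobordism from `M` to `N` (dimension `3 + 1`) with a product region `R`
over `U ⊆ M` (`Cobordism.ProductRegion`), and `ψ : M ⊇ V ⇀ 𝕊 1 × ℝ²` a solid-torus chart of `M`
(`C^∞` with `C^∞` inverse, target containing the tube of radius `2`) whose closed shell
`ψ⁻¹(𝕊 1 × {1 ≤ ‖w‖ ≤ 2})` lies in `U`. Then for all `(a, b) ∈ ℤ × ℤ` there are: the shell twist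
`k = ψ⁻¹ ∘ shellTwist a b ∘ ψ ∪ id` of `M`, its transport `g = top ∘ k ∘ top⁻¹ ∪ id` to `N` along
the product region (the Dehn twist `(z, w, t) ↦ (e^{2πiat} z, e^{2πibt} w, t)` of the toral shell
`top(U) ⊆ N`), and a self-diffeomorphism `G` of `X` with `G ∘ inr = inr ∘ g`, `G ∘ inl = inl ∘ k`
(`ProductRegion.exists_extension`), and `k` is isotopic to `id_M` (`isIsotopic_refl_of_shellTwist`,
the printed `F_s`). [cite: AkbulutRuberman2016, §3, proof of Thm. A, proof of the Claim] -/
theorem exists_extension_shellTwist [IsManifold (𝓡 3) ∞ M] (X : Cobordism 3 M N)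
    (R : X.ProductRegion)
    (ψ : OpenPartialHomeomorph M
      ((Metric.sphere (0 : EuclideanSpace ℝ (Fin 2)) 1) × EuclideanSpace ℝ (Fin 2)))
    (hψ : ContMDiffOn (𝓡 3) ((𝓡 1).prod 𝓘(ℝ, EuclideanSpace ℝ (Fin 2))) ∞ ψ ψ.source)
    (hψ' : ContMDiffOn ((𝓡 1).prod 𝓘(ℝ, EuclideanSpace ℝ (Fin 2))) (𝓡 3) ∞ ψ.symm ψ.target)
    (h2 : (univ : Set (Metric.sphere (0 : EuclideanSpace ℝ (Fin 2)) 1)) ×ˢ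
      closedBall (0 : EuclideanSpace ℝ (Fin 2)) 2 ⊆ ψ.target)
    (hU : ψ.symm '' ((univ : Set (Metric.sphere (0 : EuclideanSpace ℝ (Fin 2)) 1)) ×ˢ
      (closedBall (0 : EuclideanSpace ℝ (Fin 2)) 2 ∩ (ball (0 : EuclideanSpace ℝ (Fin 2)) 1)ᶜ)) ⊆
      R.top.source)
    (a b : ℤ) :
    ∃ (k : M ≃ₘ⟮𝓡 3, 𝓡 3⟯ M) (g : N ≃ₘ⟮𝓡 3, 𝓡 3⟯ N) (G : X.W ≃ₘ⟮𝓡∂ 4, 𝓡∂ 4⟯ X.W),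
      (∀ x ∈ ψ.source, k x = ψ.symm (shellTwist a b (ψ x))) ∧ (∀ x, x ∉ ψ.source → k x = x) ∧
      (∀ x ∈ R.top.source, g (R.top x) = R.top (k x)) ∧ (∀ y, y ∉ R.top.target → g y = y) ∧
      (∀ y, G (X.inr y) = X.inr (g y)) ∧ (∀ x, G (X.inl x) = X.inl (k x)) ∧
      Literature.Topology.FourManifolds.Diffeomorph.IsIsotopic k (Diffeomorph.refl (𝓡 3) M ∞) := by
  haveI : T2Space M := X.isSmoothEmbedding_inl.isEmbedding.t2Space
  -- the shell twist `k` of `M`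
  obtain ⟨k, hk, hk'⟩ := exists_diffeomorph_partialTransport (J := 𝓡 3)
    (J' := (𝓡 1).prod 𝓘(ℝ, EuclideanSpace ℝ (Fin 2))) ψ hψ hψ' (shellTwistDiffeo a b)
    isCompact_univ_prod_closedBall_two h2 fun y hy => by
      rw [coe_shellTwistDiffeo, ← shellTwistFamily_one]
      exact shellTwistFamily_apply_of_not_mem a b 1 hy
  simp only [coe_shellTwistDiffeo] at hk
  -- its support lies in the closed shell, a compact subset of `U`
  set K : Set M := ψ.symm '' ((univ : Set (Metric.sphere (0 : EuclideanSpace ℝ (Fin 2)) 1)) ×ˢ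
    (closedBall (0 : EuclideanSpace ℝ (Fin 2)) 2 ∩ (ball (0 : EuclideanSpace ℝ (Fin 2)) 1)ᶜ))
    with hKdef
  have hKsub : (univ : Set (Metric.sphere (0 : EuclideanSpace ℝ (Fin 2)) 1)) ×ˢ
      (closedBall (0 : EuclideanSpace ℝ (Fin 2)) 2 ∩ (ball (0 : EuclideanSpace ℝ (Fin 2)) 1)ᶜ) ⊆
      ψ.target :=
    (prod_mono Subset.rfl inter_subset_left).trans h2
  have hKc : IsCompact K :=
    ((isCompact_univ.prod ((isCompact_closedBall _ _).inter_right isOpen_ball.isClosed_compl))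
      |>.image_of_continuousOn (ψ.continuousOn_symm.mono hKsub))
  have hkK : ∀ x, x ∉ K → k x = x := by
    intro x hx
    by_cases hxs : x ∈ ψ.source
    · have hψx : ψ x ∉ (univ : Set (Metric.sphere (0 : EuclideanSpace ℝ (Fin 2)) 1)) ×ˢ
          (closedBall (0 : EuclideanSpace ℝ (Fin 2)) 2 ∩ (ball (0 : EuclideanSpace ℝ (Fin 2)) 1)ᶜ) :=
        fun h => hx ⟨ψ x, h, ψ.left_inv hxs⟩
      rw [hk x hxs, shellTwist_apply_of_not_mem_shell a b hψx, ψ.left_inv hxs]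
    · exact hk' x hxs
  -- extension over the product region and the isotopy `F_s`
  obtain ⟨G, g, hGl, hGr, hg, hg', -, -⟩ := R.exists_extension k hKc hU hkK
  have hiso := isIsotopic_refl_of_shellTwist ψ hψ hψ' h2 a b k hk hk'
  exact ⟨k, g, G, hk, hk', hg, hg', hGr, hGl, hiso⟩

/-- **The extension property of the Claim from generation by shell twists.** If `Diff(N)` is
generated up to isotopy (the closure form of `farEndDiffeosExtend_of_generators_closure`) by a
set `S` of shell twists along product regions of `X` — each `s ∈ S` is, for some product region
`R`, solid-torus chart `ψ` of `M` with closed shell in the base of `R` and `(a, b) ∈ ℤ × ℤ`, the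
transport `top ∘ k ∘ top⁻¹ ∪ id` of the shell twist `k = ψ⁻¹ ∘ shellTwist a b ∘ ψ ∪ id` of `M` —
then `X` has the extension property `FarEndDiffeosExtend X` of the Claim. This is the printed
proof of the Claim with its three-dimensional first half (the Dehn twists along the JSJ tori
`Tᵢ × [0, 1]` generate `π₀ Diff(N) ≅ ⊕ⁿ (ℤ ⊕ ℤ)`: JSJ, trivial symmetry groups, Waldhausen) as
the hypothesis `hgen`. [cite: AkbulutRuberman2016, §3, proof of Thm. A, Claim] -/
theorem farEndDiffeosExtend_of_shellTwists_generate [IsManifold (𝓡 3) ∞ M]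
    [IsManifold (𝓡 3) ∞ N] (X : Cobordism 3 M N) (S : Set (N ≃ₘ⟮𝓡 3, 𝓡 3⟯ N))
    (hS : ∀ s ∈ S, ∃ (R : X.ProductRegion)
      (ψ : OpenPartialHomeomorph M
        ((Metric.sphere (0 : EuclideanSpace ℝ (Fin 2)) 1) × EuclideanSpace ℝ (Fin 2)))
      (a b : ℤ),
      ContMDiffOn (𝓡 3) ((𝓡 1).prod 𝓘(ℝ, EuclideanSpace ℝ (Fin 2))) ∞ ψ ψ.source ∧
      ContMDiffOn ((𝓡 1).prod 𝓘(ℝ, EuclideanSpace ℝ (Fin 2))) (𝓡 3) ∞ ψ.symm ψ.target ∧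
      (univ : Set (Metric.sphere (0 : EuclideanSpace ℝ (Fin 2)) 1)) ×ˢ
        closedBall (0 : EuclideanSpace ℝ (Fin 2)) 2 ⊆ ψ.target ∧
      ψ.symm '' ((univ : Set (Metric.sphere (0 : EuclideanSpace ℝ (Fin 2)) 1)) ×ˢ
        (closedBall (0 : EuclideanSpace ℝ (Fin 2)) 2 ∩
          (ball (0 : EuclideanSpace ℝ (Fin 2)) 1)ᶜ)) ⊆ R.top.source ∧
      (∀ x ∈ R.top.source, x ∈ ψ.source → s (R.top x) = R.top (ψ.symm (shellTwist a b (ψ x)))) ∧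
      (∀ x ∈ R.top.source, x ∉ ψ.source → s (R.top x) = R.top x) ∧
      (∀ y, y ∉ R.top.target → s y = y))
    (hgen : ∀ T : Set (N ≃ₘ⟮𝓡 3, 𝓡 3⟯ N), S ⊆ T → Diffeomorph.refl (𝓡 3) N ∞ ∈ T →
      (∀ g₁ ∈ T, ∀ g₂ ∈ T, g₁.trans g₂ ∈ T) → (∀ g ∈ T, g.symm ∈ T) →
      (∀ g ∈ T, ∀ g', Literature.Topology.FourManifolds.Diffeomorph.IsIsotopic g g' → g' ∈ T) →
      ∀ g, g ∈ T) :
    FarEndDiffeosExtend X := by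
  refine farEndDiffeosExtend_of_generators_closure X S (fun s hs => ?_) hgen
  obtain ⟨R, ψ, a, b, hψ, hψ', h2, hU, hs1, hs2, hs3⟩ := hS s hs
  obtain ⟨k, g, G, hk, hk', hg, hg', hGr, hGl, hiso⟩ :=
    exists_extension_shellTwist X R ψ hψ hψ' h2 hU a b
  have hsg : s = g := by
    refine Diffeomorph.ext fun y => ?_
    by_cases hy : y ∈ R.top.target
    · have hx : R.top.symm y ∈ R.top.source := R.top.map_target hy
      rw [← R.top.right_inv hy, hg _ hx]
      by_cases hxs : R.top.symm y ∈ ψ.source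
      · rw [hs1 _ hx hxs, hk _ hxs]
      · rw [hs2 _ hx hxs, hk' _ hxs]
    · rw [hs3 y hy, hg' y hy]
  subst hsg
  exact ⟨G, k, hGr, hGl, hiso⟩

end Literature.Barriers.SmoothPoincare4

end
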